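import Summits.QuantumFields.YangMills.Theorems.BalabanUVNodesPortS1Chi29Window
import Summits.QuantumFields.YangMills.Theorems.BalabanUVNodesPortS1FEStepHalves

/-!
# BalabanUVNodes — port (S1), FE-1 brick (D1)∕R8 at DEF-1's chart variable: the re-parametrised variable `Y_g(x) = g·x − hD̃(g·x)` (✓`recordReparamOf`) agrees with `g·x` OFF the distinguished bonds
  `b₀(c)` (the `D̃`-correction ✓`recordDtCorrOf` lives on the `b₀`-rows only, ✓`hopLinGraphC_apply_of_not_mem`), hence ON THE FIBRE the record's (2.9) cut-off at the charted configuration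
  `pert … (V^{(k)}_{ax}(W)) (Y_g(x))` IS the socket cut-off `chiFluctPrinted (feChartRadius ε₂₉ g) (fluctVec x)` — the χ-row of FE-1's chart law at DEF-1's own objects
  (porter hand `hand-27930-FE-1` g0, cell `ym-nodeO-ideate`; design word (D1) of ✓`…K0RecordFormatNamesFluctG`∕(c3) of ✓`…FluctInt` confirmed BY NAME)

`--supports stmt-QuantumFields-27930` (helper; NO `--workitem`); count-neutral.  [I] = [Balaban1987RG1].

CONTENT: `recordDtCorrOf_apply_of_not_isB0` (the correction vanishes off `b₀`), ★ `recordReparamOf_apply_of_not_isB0` (`Y_g(x)(b, a) = g·x(b, a)` off `b₀`),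
★★ `chiFix29AxOfRecord_reparam_eq_chiFluctPrinted` (✓`chiFix29AxOfRecord_eq_chiFluctPrinted` with its hypothesis `hY` DISCHARGED at `Y := recordReparamOf F k Dt Vk g x`, any socket `Dt`, any centre
`Vk`; remaining hypotheses: the fibre `V̄ = W`, the off-`b₀` chart reading of `V`, the injectivity window `g·‖x_b‖ ≤ π` off `b₀`, `0 < g`, `0 < ε₂₉ ≤ 2`).
DEDUP: 3 new names, 0 tree hits; everything else IMPORTED by name.

HONEST STATUS.  Definition chasing; NOTHING of Bałaban's chart law, exponent algebra or cluster expansion asserted, ported or discharged; `stub_FE` ∕ `stub_P0C` OPEN; ⟨27930⟩ OPEN (1∕3); NODE O 0∕1;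
COUNT 8∕28 · K 1∕4 UNMOVED; finite 𝕋⁴_{L^K} at fixed ε — NOT continuum ∕ OS ∕ Clay; **the Yang–Mills mass gap (Clay) is NOT proved by any of this.**  No `sorry`; standard axioms.

References: T. Bałaban, *Renormalization group approach to lattice gauge field theories. I*, Comm. Math. Phys. 109 (1987) 249–301 [Balaban1987RG1] — (2.9) p.266, p.267 («hB is equal to 0 everywhere,
except the set {b₀(c)}»), p.268 («B = g_kB′»).
-/

noncomputable section

namespace Summit.QuantumFields.YangMills.Theorems.BalabanUVNodesPortS1

open Summit.QuantumFields.YangMills.Theorems.K0RecordFormatNames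
open Literature.MathematicalPhysics.QuantumFieldTheory.Balaban1983to89
open Literature.MathematicalPhysics.QuantumFieldTheory.Balaban1983to89.Node00
open Literature.MathematicalPhysics.QuantumFieldTheory.Balaban1983to89.T4Continuum (T4Family)
open Literature.MathematicalPhysics.QuantumFieldTheory.Balaban1983to89.B12SmallFieldDomain259 (chiFluctPrinted)

variable (F : T4Family)

/-- A bond off print's distinguished set `{b₀(c)}` is off the range of DEF-1's `recordB0` (the two namings of `b₀` agree definitionally: `B12SmallFieldDomain259.b0 = centralBond`).
[cite: Balaban1987RG1, p.267 (b₀(c)) (bookkeeping)] -/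
theorem not_mem_range_recordB0_of_not_isB0 {K k : ℕ} {b : PBond (F.P K) k} (hb : ¬ IsB0 (F := F) b) : b ∉ Set.range (recordB0 F k K) :=
  fun ⟨c, hc⟩ => hb ⟨c, hc⟩

/-- **The `D̃`-correction vanishes off `b₀`** (print p.267: «hB is equal to 0 everywhere, except the set {b₀(c)}»; ✓`hopLinGraphC_apply_of_not_mem`). [cite: Balaban1987RG1, p.267] -/
theorem recordDtCorrOf_apply_of_not_isB0 (k : ℕ) {K : ℕ} (Dt : GaugeField (F.P K) k (SU 2) → (FluctIdx F k K → ℂ) → (PBond (F.P K) (k + 1) → MatA 2))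
    (Vk : GaugeField (F.P K) k (SU 2)) (y : FluctIdx F k K → ℝ) {b : PBond (F.P K) k} (hb : ¬ IsB0 (F := F) b) (a : Fin 3) :
    recordDtCorrOf F k Dt Vk y (b, a) = 0 := by
  unfold recordDtCorrOf
  rw [hopLinGraphC_apply_of_not_mem F k K Vk _ (b, a) (not_mem_range_recordB0_of_not_isB0 F hb), Complex.zero_re]

/-- ★ **Off `b₀` the re-parametrised variable is the scaled one**: `Y_g(x)(b, a) = g·x(b, a)` for `b ∉ {b₀(c)}`. [cite: Balaban1987RG1, p.267–268] -/
theorem recordReparamOf_apply_of_not_isB0 (k : ℕ) {K : ℕ} (Dt : GaugeField (F.P K) k (SU 2) → (FluctIdx F k K → ℂ) → (PBond (F.P K) (k + 1) → MatA 2))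
    (Vk : GaugeField (F.P K) k (SU 2)) (g : ℝ) (x : FluctIdx F k K → ℝ) {b : PBond (F.P K) k} (hb : ¬ IsB0 (F := F) b) (a : Fin 3) :
    recordReparamOf F k Dt Vk g x (b, a) = g * x (b, a) := by
  unfold recordReparamOf
  rw [Pi.sub_apply, recordDtCorrOf_apply_of_not_isB0 F k Dt Vk _ hb a, sub_zero, Pi.smul_apply, smul_eq_mul]

/-- ★★ **THE χ-ROW OF FE-1 AT DEF-1's OBJECTS**: on the fibre `V̄ = W`, if off `b₀` the configuration is the charted one at DEF-1's re-parametrised variable, `V b = pert … (V^{(k)}_{ax}(W)) (Y_g(x)) b`,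
with the scaled variable inside the injectivity window off `b₀`, then `χ^{(2.9)}_{k,ax}(V) = chiFluctPrinted (feChartRadius ε₂₉ g) (fluctVec F k K x)` — whatever the socket `Dt` and the centre `Vk`
used by the re-parametrisation (the correction is invisible to the cut-off). [cite: Balaban1987RG1, (2.9) p.266, p.267, p.268] -/
theorem chiFix29AxOfRecord_reparam_eq_chiFluctPrinted (ν : Stage7Numerics) {ε₂₉ g : ℝ} (hε₀ : 0 < ε₂₉) (hε₂ : ε₂₉ ≤ 2) (hg : 0 < g)
    {K k : ℕ} (Dt : GaugeField (F.P K) k (SU 2) → (FluctIdx F k K → ℂ) → (PBond (F.P K) (k + 1) → MatA 2)) (Vk : GaugeField (F.P K) k (SU 2))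
    {W : GaugeField (F.P K) (k + 1) (SU 2)} {V : GaugeField (F.P K) k (SU 2)}
    (hfib : (avOfRecord F 2 K k).avg V = W) {x : FluctIdx F k K → ℝ}
    (hV : ∀ b : PBond (F.P K) k, ¬ IsB0 b → V b = pert F k K (critCfgAxOfRecord F 2 ν K k W) (recordReparamOf F k Dt Vk g x) b)
    (hwin : ∀ b : PBond (F.P K) k, ¬ IsB0 b → g * ‖fluctVec F k K x b‖ ≤ Real.pi) :
    chiFix29AxOfRecord F 2 ν ε₂₉ K k V = chiFluctPrinted (feChartRadius ε₂₉ g) (fluctVec F k K x) := by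
  rw [feChartRadius]
  exact chiFix29AxOfRecord_eq_chiFluctPrinted F ν hε₀ hε₂ hg hfib hV
    (fun b hb a => recordReparamOf_apply_of_not_isB0 F k Dt Vk g x hb a) hwin

-- standard axioms only
#print axioms chiFix29AxOfRecord_reparam_eq_chiFluctPrinted

end Summit.QuantumFields.YangMills.Theorems.BalabanUVNodesPortS1

end
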